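import Summits.AtomisticToContinuum.Crystallization.Theorems.FrustratedLawDichotomyCellZFrameA

/-!
# FrustratedLawDichotomy · crux `AperiodicFrustratedLawGap` (stmt-AtomisticToContinuum-27623) — THE CLASS-Z CELL FRAME, PART B (lens-5 g114 node 460bb4df,
# LANE EDITION hand-2 g48 for the 400-line limit, r1868 GO (373)): §3 the Z row set over the rational grid (`rowZ`, `gridZ`, `cellRowZ`, `measurableSet_cellRowZ`)
# and §4 the inhabitation witness (`halfCrystal_mem_coherentOn_inter_dFacing`, `straddleFree_of_intHeights`).  Same namespace as PART A
# (`…CellZFrameA`: §1 `tplZ` + plane conjunct, §2 `wPlus`/`kRef` envelopes + dischargers, §2b `normalBox` brackets); statements and proofs verbatim.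
-/

noncomputable section

namespace Summit.AtomisticToContinuum.Crystallization.Theorems.FrustratedLawDichotomyCellZFrame

open MeasureTheory Metric Set
open scoped BigOperators RealInnerProductSpace
open Literature.MathematicalPhysics.StatisticalMechanics (lennardJones)
open Literature.Probability.Process (IsRootedHardCore count_restrict_singleton_ne_zero_iff)
open Summit.AtomisticToContinuum.Crystallization.Theorems.ChargedEnergyGapNegative (E3)
open Summit.AtomisticToContinuum.Crystallization.Theorems.FrustratedLawDichotomyCoherentOn (coherentOn measurableSet_coherentOn)
open Summit.AtomisticToContinuum.Crystallization.Theorems.FrustratedLawDichotomyCoherentFloorHalo (haloWindow measurableSet_haloWindow)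
open Summit.AtomisticToContinuum.Crystallization.Theorems.FrustratedLawDichotomyCellMetric (posL gram inner_posL posL_zero le_norm_posL)
open Summit.AtomisticToContinuum.Crystallization.Theorems.FrustratedLawDichotomyCellData (gram_ge_nearId)
open Summit.AtomisticToContinuum.Crystallization.Theorems.FrustratedLawDichotomyCellRows (ratBox ratBox_countable mem_ratBox)
open Summit.AtomisticToContinuum.Crystallization.Theorems.FrustratedLawDichotomyCellHaloNormal
  (nL sL inner_nL_le_sL_iff inner_add_le_sL norm_posL_le_bracket gram_le_dot_add dot_sub_le_gram)
open Summit.AtomisticToContinuum.Crystallization.Theorems.FrustratedLawDichotomyZoneKernel (DFacing measurableSet_dFacing mem_dFacing_of_pointwise)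
open Summit.AtomisticToContinuum.Crystallization.Theorems.FrustratedLawDichotomyZoneFloor
  (lennardJones_interval_floor neg_lennardJones_le_abs_of_one_le)
open Summit.AtomisticToContinuum.Crystallization.Theorems.FrustratedLawDichotomyCoherentInhabited (image_mem_coherentOn_of_complete)

variable {ι : Type*}

/-! ## §3. The Z row set over the rational grid -/

/-- ★ THE Z ROW over a parameter set `B`: coherent with the grid-point template on the halo window AND D-facing there. -/
def rowZ {κ : Type*} (B : Set κ) (MF : κ → Finset ι) (posF : κ → ι → E3) (nF : κ → E3) (sF : κ → ℝ) (τ Rw δ : ℝ)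
    (Hm : Measure E3 → E3 → Prop) (Rz : ℝ) : Set (Measure E3) :=
  ⋃ k ∈ B, coherentOn ((MF k).image (posF k)) τ (haloWindow (nF k) (sF k) Rw) ∩ DFacing δ Hm Rz (nF k) (sF k)

section Row

variable {κ : Type*} {B : Set κ} {MF : κ → Finset ι} {posF : κ → ι → E3} {nF : κ → E3} {sF : κ → ℝ} {τ Rw δ Rz : ℝ}
  {Hm : Measure E3 → E3 → Prop} {μ : Measure E3}

/-- The Z row over a countable parameter set is measurable for a jointly measurable mark (the `hK` clause). [folklore] -/
theorem measurableSet_rowZ (hB : B.Countable) (hδ : 0 < δ) (hmeas : MeasurableSet {p : Measure E3 × E3 | Hm p.1 p.2}) :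
    MeasurableSet (rowZ B MF posF nF sF τ Rw δ Hm Rz) :=
  MeasurableSet.biUnion hB fun _ _ =>
    (measurableSet_coherentOn _ _ (measurableSet_haloWindow _ _ _)).inter (measurableSet_dFacing hδ hmeas _ _ _)

/-- A configuration coherent and D-facing at a grid point is in the row. [folklore] -/
theorem mem_rowZ_of_mem {k : κ} (hk : k ∈ B) (hcoh : μ ∈ coherentOn ((MF k).image (posF k)) τ (haloWindow (nF k) (sF k) Rw))
    (hD : μ ∈ DFacing δ Hm Rz (nF k) (sF k)) : μ ∈ rowZ B MF posF nF sF τ Rw δ Hm Rz :=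
  Set.mem_biUnion hk ⟨hcoh, hD⟩

/-- A row member is coherent and D-facing at some grid point. [folklore] -/
theorem exists_of_mem_rowZ (h : μ ∈ rowZ B MF posF nF sF τ Rw δ Hm Rz) :
    ∃ k ∈ B, μ ∈ coherentOn ((MF k).image (posF k)) τ (haloWindow (nF k) (sF k) Rw) ∧ μ ∈ DFacing δ Hm Rz (nF k) (sF k) := by
  simpa only [rowZ, Set.mem_iUnion, Set.mem_inter_iff, exists_prop] using h

end Row

/-- rational label vectors. -/
def ratVecs : Set (Fin 3 → ℝ) := Set.range fun g : Fin 3 → ℚ => fun i => (g i : ℝ)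

/-- Rational label vectors are countable. [folklore] -/
theorem ratVecs_countable : ratVecs.Countable := Set.countable_range _

/-- rational levels. -/
def ratReals : Set ℝ := Set.range ((↑) : ℚ → ℝ)

/-- Rational levels are countable. [folklore] -/
theorem ratReals_countable : ratReals.Countable := Set.countable_range _

/-- ★ THE Z GRID of a cell: rational `(F, n₁, S)` in (strain box) × (normal box) × (band). -/
def gridZ (B : Set (Matrix (Fin 3) (Fin 3) ℝ)) (N : Set (Fin 3 → ℝ)) (J : Set ℝ) : Set (Matrix (Fin 3) (Fin 3) ℝ × (Fin 3 → ℝ) × ℝ) :=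
  ratBox B ×ˢ ((N ∩ ratVecs) ×ˢ (J ∩ ratReals))

/-- The Z grid is countable (so the row is a countable union). [folklore] -/
theorem gridZ_countable (B : Set (Matrix (Fin 3) (Fin 3) ℝ)) (N : Set (Fin 3 → ℝ)) (J : Set ℝ) : (gridZ B N J).Countable :=
  (ratBox_countable B).prod ((ratVecs_countable.mono Set.inter_subset_right).prod (ratReals_countable.mono Set.inter_subset_right))

/-- Membership in the Z grid. [folklore] -/
theorem mem_gridZ {B : Set (Matrix (Fin 3) (Fin 3) ℝ)} {N : Set (Fin 3 → ℝ)} {J : Set ℝ} {k : Matrix (Fin 3) (Fin 3) ℝ × (Fin 3 → ℝ) × ℝ} :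
    k ∈ gridZ B N J ↔ k.1 ∈ ratBox B ∧ (k.2.1 ∈ N ∧ k.2.1 ∈ ratVecs) ∧ (k.2.2 ∈ J ∧ k.2.2 ∈ ratReals) := by
  simp only [gridZ, Set.mem_prod, Set.mem_inter_iff]

/-- Grid points in the boxes (the Z row's `B`/`N`/`J` facts at a grid point). [folklore] -/
theorem boxes_of_mem_gridZ {B : Set (Matrix (Fin 3) (Fin 3) ℝ)} {N : Set (Fin 3 → ℝ)} {J : Set ℝ}
    {k : Matrix (Fin 3) (Fin 3) ℝ × (Fin 3 → ℝ) × ℝ} (hk : k ∈ gridZ B N J) : k.1 ∈ B ∧ k.2.1 ∈ N ∧ k.2.2 ∈ J := by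
  rw [mem_gridZ] at hk
  exact ⟨Set.inter_subset_left hk.1, hk.2.1.1, hk.2.2.1⟩

/-- A rational triple in the boxes is a grid point. [folklore] -/
theorem mem_gridZ_of_rat {B : Set (Matrix (Fin 3) (Fin 3) ℝ)} {N : Set (Fin 3 → ℝ)} {J : Set ℝ} (f : Fin 3 → Fin 3 → ℚ) (g : Fin 3 → ℚ)
    (q : ℚ) (hF : (Matrix.of fun i j => (f i j : ℝ)) ∈ B) (hn : (fun i => (g i : ℝ)) ∈ N) (hS : (q : ℝ) ∈ J) :
    ((Matrix.of fun i j => (f i j : ℝ)), (fun i => (g i : ℝ)), (q : ℝ)) ∈ gridZ B N J :=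
  mem_gridZ.2 ⟨mem_ratBox f hF, ⟨hn, g, rfl⟩, ⟨hS, q, rfl⟩⟩

/-- ★ **THE Z CELL ROW SET `K_Z`** (amendment D §D1): the union over the rational grid of `coherentOn (tplZ-image) τ W ∩ DFacing`. -/
def cellRowZ (Mrad : Finset ι) (a : ι → Fin 3 → ℝ) (B : Set (Matrix (Fin 3) (Fin 3) ℝ)) (N : Set (Fin 3 → ℝ)) (J : Set ℝ)
    (τ Rw δ : ℝ) (Hm : Measure E3 → E3 → Prop) (Rz : ℝ) : Set (Measure E3) :=
  rowZ (gridZ B N J) (fun k => tplZ Mrad a τ k.1 k.2.1 k.2.2) (fun k z => posL k.1 (a z)) (fun k => nL k.1 k.2.1)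
    (fun k => sL k.1 k.2.1 k.2.2) τ Rw δ Hm Rz

/-- `K_Z` is measurable (the `hK_Z` clause of the registry line). [folklore] -/
theorem measurableSet_cellRowZ (Mrad : Finset ι) (a : ι → Fin 3 → ℝ) (B : Set (Matrix (Fin 3) (Fin 3) ℝ))
    (N : Set (Fin 3 → ℝ)) (J : Set ℝ) (τ Rw : ℝ) {δ : ℝ} (hδ : 0 < δ) {Hm : Measure E3 → E3 → Prop}
    (hmeas : MeasurableSet {p : Measure E3 × E3 | Hm p.1 p.2}) (Rz : ℝ) : MeasurableSet (cellRowZ Mrad a B N J τ Rw δ Hm Rz) :=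
  measurableSet_rowZ (gridZ_countable B N J) hδ hmeas

/-! ## §4. ★★ The inhabitation witness: the ideal half-crystal at a straddle-free grid point -/

/-- ★ STRADDLE-FREENESS FROM INTEGER HEIGHTS: heights `λ·t(z)` (`t(z) ∈ ℤ`), level `S = λ(k + ½)`, half-gap `λ/2 ≥ τN` — every admissible site is
exactly below (tube included) or strictly above. [folklore] -/
theorem straddleFree_of_intHeights {κ : Type*} {adm : κ → Prop} {H : κ → ℝ} (ht : κ → ℤ) {lam S τN : ℝ} (k : ℤ) (hlam : 0 < lam)
    (hH : ∀ z, adm z → H z = lam * ht z) (hS : S = lam * (k + 1 / 2)) (hm : τN ≤ lam / 2) :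
    ∀ z, adm z → H z + τN ≤ S ∨ S < H z := by
  intro z hz
  rw [hH z hz, hS]
  rcases le_or_gt (ht z) k with h | h
  · left
    have h' : (ht z : ℝ) ≤ k := by exact_mod_cast h
    nlinarith
  · right
    have h' : (k : ℝ) + 1 ≤ ht z := by exact_mod_cast h
    nlinarith

/-- ★★ **THE INHABITATION WITNESS OF A Z CELL** (amendment D §D4).  At a grid point `(F, n₁, S)` at which the admissible lattice is
STRADDLE-FREE (`hsf`), the ideal half-crystal `L = F a '' {z adm | gram(FᵀF)(a z, n₁) ≤ S}` lies in `coherentOn (tplZ-image) τ W ∩ DFacing`: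
coherence by (364) `image_mem_coherentOn_of_complete` (template ⊆ half-crystal trivially; completeness from the RADIAL completeness `hcompR` of
`Mrad` and straddle-freeness), D-facing VACUOUSLY (every atom of `L` has `⟪q, nL⟫ ≤ sL`; nothing about the mark is used), hard core from the
host separation at `F`.  [folklore] -/
theorem halfCrystal_mem_coherentOn_inter_dFacing {κ : Type*} (adm : κ → Prop) (a : κ → Fin 3 → ℝ) (Mrad : Finset κ)
    (F : Matrix (Fin 3) (Fin 3) ℝ) (n₁ : Fin 3 → ℝ) {S τ Rw Rz δ : ℝ} (Hm : Measure E3 → E3 → Prop)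
    (hδ : 0 < δ) (hτ : 0 ≤ τ) (hN : 0 < ‖posL F n₁‖) (hS : 0 ≤ S)
    (hMrad : ∀ z ∈ Mrad, adm z) (hcompR : ∀ z, adm z → ‖posL F (a z)‖ ≤ Rw → z ∈ Mrad)
    (hsf : ∀ z, adm z → gram (F.transpose * F) (a z) n₁ + τ * ‖posL F n₁‖ ≤ S ∨ S < gram (F.transpose * F) (a z) n₁)
    {o : κ} (ho : adm o) (ho0 : a o = 0)
    (hsep : ∀ z z', adm z → adm z' → posL F (a z) ≠ posL F (a z') → δ ≤ dist (posL F (a z)) (posL F (a z'))) :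
    (Measure.count.restrict ((fun z => posL F (a z)) '' {z | adm z ∧ gram (F.transpose * F) (a z) n₁ ≤ S}) : Measure E3) ∈
      coherentOn ((tplZ Mrad a τ F n₁ S).image fun z => posL F (a z)) τ (haloWindow (nL F n₁) (sL F n₁ S) Rw) ∩
        DFacing δ Hm Rz (nL F n₁) (sL F n₁ S) := by
  set pos : κ → E3 := fun z => posL F (a z) with hpos
  set adm' : κ → Prop := fun z => adm z ∧ gram (F.transpose * F) (a z) n₁ ≤ S with hadm'
  have hτN : 0 ≤ τ * ‖posL F n₁‖ := mul_nonneg hτ (norm_nonneg _)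
  refine ⟨?_, ?_⟩
  · refine image_mem_coherentOn_of_complete adm' pos _ (measurableSet_haloWindow _ _ _) hτ (fun z hz => ?_) (fun z hz hzW => ?_)
    · rw [mem_tplZ] at hz
      exact ⟨hMrad z hz.1, by linarith [hz.2]⟩
    · have hzR : ‖pos z‖ ≤ Rw := mem_closedBall_zero_iff.1 hzW.1
      rw [mem_tplZ]
      refine ⟨hcompR z hz.1 hzR, ?_⟩
      rcases hsf z hz.1 with h | h
      · exact h
      · exact absurd hz.2 (not_le.2 h)
  · have hμ : IsRootedHardCore δ (Measure.count.restrict (pos '' {z | adm' z}) : Measure E3) := by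
      refine ⟨pos '' {z | adm' z}, ⟨o, ⟨ho, ?_⟩, ?_⟩, ?_, rfl⟩
      · show gram (F.transpose * F) (a o) n₁ ≤ S
        rw [ho0, gram_zero_left]
        exact hS
      · show posL F (a o) = 0
        rw [ho0, posL_zero]
      · rintro p ⟨z, hz, rfl⟩ p' ⟨z', hz', rfl⟩ hne
        exact hsep z z' hz.1 hz'.1 hne
    refine mem_dFacing_of_pointwise hδ hμ fun q hq _ hqs => ?_
    obtain ⟨z, hz, rfl⟩ := (count_restrict_singleton_ne_zero_iff _ q).1 hq
    have h1 : ⟪pos z, nL F n₁⟫ ≤ sL F n₁ S := by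
      rw [inner_nL_le_sL_iff F n₁ hN, hpos, inner_posL]
      exact hz.2
    exact absurd hqs (not_lt.2 h1)

/-- ★ …hence the Z cell row set `K_Z` is INHABITED by that half-crystal whenever the grid point is rational and in the boxes (the registry's
`rowCell_KZ_inhabited`; per cell the K-file supplies the rational data, `hsf` by `straddleFree_of_intHeights`, `hcompR` = the Labels file's
radial completeness, `hsep` = the host separation at `F`). [folklore] -/
theorem halfCrystal_mem_cellRowZ {κ : Type*} (adm : κ → Prop) (a : κ → Fin 3 → ℝ) (Mrad : Finset κ)
    {B : Set (Matrix (Fin 3) (Fin 3) ℝ)} {N : Set (Fin 3 → ℝ)} {J : Set ℝ} (f : Fin 3 → Fin 3 → ℚ) (g : Fin 3 → ℚ) (q : ℚ)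
    {τ Rw Rz δ : ℝ} (Hm : Measure E3 → E3 → Prop)
    (hF : (Matrix.of fun i j => (f i j : ℝ)) ∈ B) (hn : (fun i => (g i : ℝ)) ∈ N) (hq : (q : ℝ) ∈ J)
    (hδ : 0 < δ) (hτ : 0 ≤ τ) (hN : 0 < ‖posL (Matrix.of fun i j => (f i j : ℝ)) (fun i => (g i : ℝ))‖) (hS : 0 ≤ (q : ℝ))
    (hMrad : ∀ z ∈ Mrad, adm z) (hcompR : ∀ z, adm z → ‖posL (Matrix.of fun i j => (f i j : ℝ)) (a z)‖ ≤ Rw → z ∈ Mrad)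
    (hsf : ∀ z, adm z →
      gram ((Matrix.of fun i j => (f i j : ℝ)).transpose * Matrix.of fun i j => (f i j : ℝ)) (a z) (fun i => (g i : ℝ)) +
          τ * ‖posL (Matrix.of fun i j => (f i j : ℝ)) (fun i => (g i : ℝ))‖ ≤ q ∨
        (q : ℝ) < gram ((Matrix.of fun i j => (f i j : ℝ)).transpose * Matrix.of fun i j => (f i j : ℝ)) (a z) (fun i => (g i : ℝ)))
    {o : κ} (ho : adm o) (ho0 : a o = 0)
    (hsep : ∀ z z', adm z → adm z' → posL (Matrix.of fun i j => (f i j : ℝ)) (a z) ≠ posL (Matrix.of fun i j => (f i j : ℝ)) (a z') →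
      δ ≤ dist (posL (Matrix.of fun i j => (f i j : ℝ)) (a z)) (posL (Matrix.of fun i j => (f i j : ℝ)) (a z'))) :
    (Measure.count.restrict ((fun z => posL (Matrix.of fun i j => (f i j : ℝ)) (a z)) ''
        {z | adm z ∧ gram ((Matrix.of fun i j => (f i j : ℝ)).transpose * Matrix.of fun i j => (f i j : ℝ)) (a z) (fun i => (g i : ℝ)) ≤ q}) :
          Measure E3) ∈ cellRowZ Mrad a B N J τ Rw δ Hm Rz := by
  have h := halfCrystal_mem_coherentOn_inter_dFacing adm a Mrad (Matrix.of fun i j => (f i j : ℝ)) (fun i => (g i : ℝ)) (Rz := Rz) Hm hδ hτ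
    hN hS hMrad hcompR hsf ho ho0 hsep
  exact mem_rowZ_of_mem (mem_gridZ_of_rat f g q hF hn hq) h.1 h.2

/-! ## §5 (appended, hand-2 g48, critic r1870 (C)(iii)) Straddle-freeness from integer heights, INTERVAL form -/

/-- ★ STRADDLE-FREENESS FROM INTEGER HEIGHTS, INTERVAL FORM (census's witness recipe of record, r1870 (C)(iii)): heights `λ·t(z)` (`t(z) ∈ ℤ`),
any level `S` with `λk + τN ≤ S < λ(k + 1)` — every admissible site is exactly below (tube included) or strictly above.  The midpoint lemma
`straddleFree_of_intHeights` (`S = λ(k + ½)`, `τN ≤ λ/2`) is the special case. [folklore] -/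
theorem straddleFree_of_intHeights' {κ : Type*} {adm : κ → Prop} {H : κ → ℝ} (ht : κ → ℤ) {lam S τN : ℝ} (k : ℤ) (hlam : 0 < lam)
    (hH : ∀ z, adm z → H z = lam * ht z) (hlo : lam * k + τN ≤ S) (hhi : S < lam * (k + 1)) :
    ∀ z, adm z → H z + τN ≤ S ∨ S < H z := by
  intro z hz
  rw [hH z hz]
  rcases le_or_gt (ht z) k with h | h
  · left
    have h' : (ht z : ℝ) ≤ k := by exact_mod_cast h
    nlinarith
  · right
    have h' : (k : ℝ) + 1 ≤ ht z := by exact_mod_cast h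
    nlinarith

end Summit.AtomisticToContinuum.Crystallization.Theorems.FrustratedLawDichotomyCellZFrame

end
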